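import Summits.ResolutionOfSingularities.ResolutionOfSingularities.Theorems.PAlterationPialtTameNormalization
import Summits.ResolutionOfSingularities.ResolutionOfSingularities.Theorems.PAlterationPialtStubRRStability
import Summits.ResolutionOfSingularities.ResolutionOfSingularities.Theorems.PAlterationPialtStubReordering
import HarnessLib

/-!
# `Pialt` (crux stmt-ResolutionOfSingularities-0555), line `SketchIdeator2` / Card A: transfer of tameness, IV — ascent

Helper file for the OPEN stub `stub_tameResolution` (`TameResolution_p`) of the lead's skeleton
`radicially-regular-endgame` (`--supports stmt-ResolutionOfSingularities-0555`; it does not close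
the item). Step T4′ of `Cruxes/Pialt/STUB-PLAN-stub_tameResolution.md` (the ascent direction of
T4, `PAlterationPialtTameDescent.lean`).

* `tame_of_finite_universallyInjective_surjective_ascent` — over a perfect field, tameness
  ASCENDS along finite radicial surjective covers `g : X' → X` of a NORMAL variety `X`: pull a
  tame model `ρ : Z → X` back along `g` and reduce, `P := (X' ×_X Z)_red`; `P → X'` is proper
  birational (`stub_reducedPullbackTransfer`), `P → Z` is a finite radicial cover of the normal
  LRR `Z`, so `P` is LRR (`stub_lrr_of_finite_universallyInjective`), and its normalisation is a
  tame resolution of `X'` (`tame_of_lrr_modification`). Together with the descent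
  `tame_of_finite_universallyInjective_surjective`: **over perfect fields tameness is INVARIANT
  under finite radicial covers of normal varieties** — the stability that regularity lacks
  (barrier `InseparableBaseChange`).
-/

set_option linter.dupNamespace false -- mandated namespace of this single-conjunct summit

noncomputable section

open CategoryTheory CategoryTheory.Limits AlgebraicGeometry TopologicalSpace
open Literature.AlgebraicGeometry.Resolution
open Scheme.IdealSheafData

namespace Summit.ResolutionOfSingularities.ResolutionOfSingularities.Theorems.Pialt.RadiciallyRegular

/-! ## Ascent along finite radicial covers of normal varieties (T4′) -/

/-- **Over a perfect field, tameness ascends along finite radicial surjective covers of normal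
varieties.** Let `k` be perfect of characteristic `p`, `g : X' → X` finite, universally
injective and surjective between integral schemes, `X` normal and locally of finite type over
`k`. If `X` has a tame resolution `ρ : Z → X`, so does `X'`: the reduced fibre product
`P := (X' ×_X Z)_red` is integral, proper birational over `X'` (`stub_reducedPullbackTransfer`)
and a finite radicial surjective cover of the normal LRR `Z`, hence LRR
(`stub_lrr_of_finite_universallyInjective`); normalise (`tame_of_lrr_modification`).
[cite: Temkin2013, Rem. 1.3.5(i)] -/
theorem tame_of_finite_universallyInjective_surjective_ascent (p : ℕ) (hp : p.Prime) (k : Type)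
    [Field k] [CharP k p] [PerfectField k] (X' X : Scheme.{0}) [IsIntegral X'] [IsIntegral X]
    (f : X ⟶ Spec (.of k)) [LocallyOfFiniteType f] (g : X' ⟶ X) [IsFinite g]
    [UniversallyInjective g] (hsurj : Function.Surjective g.base)
    (h : ∃ (Z : Scheme.{0}) (π : Z ⟶ X), IsProper π ∧ IsBirational π ∧ IsIntegral Z ∧
      (∀ z : Z, IsIntegrallyClosed (Z.presheaf.stalk z)) ∧
      ∀ z : Z, ∃ U : Z.Opens, z ∈ U ∧ ∃ (W : Scheme.{0}) (h : W ⟶ (U : Scheme.{0})),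
        IsIntegral W ∧ Scheme.IsRegular W ∧ IsFinite h ∧ UniversallyInjective h ∧
          Function.Surjective h.base) :
    ∃ (Z : Scheme.{0}) (π : Z ⟶ X'), IsProper π ∧ IsBirational π ∧ IsIntegral Z ∧
      (∀ z : Z, IsIntegrallyClosed (Z.presheaf.stalk z)) ∧
      ∀ z : Z, ∃ U : Z.Opens, z ∈ U ∧ ∃ (W : Scheme.{0}) (h : W ⟶ (U : Scheme.{0})),
        IsIntegral W ∧ Scheme.IsRegular W ∧ IsFinite h ∧ UniversallyInjective h ∧
          Function.Surjective h.base := by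
  haveI : Surjective g := ⟨hsurj⟩
  obtain ⟨Z, ρ, hρprop, hρbir, hZint, hZn, hZlrr⟩ := h
  haveI := hρprop
  haveI := hZint
  -- the reduced fibre product `P := (X' ×_X Z)_red`
  haveI hPint : IsIntegral (vanishingIdeal (⊤ : Closeds ↑(pullback g ρ))).subscheme :=
    isIntegral_reduced_pullback g ρ
  have hbirP : IsBirational
      ((vanishingIdeal (⊤ : Closeds ↑(pullback g ρ))).subschemeι ≫ pullback.fst g ρ) :=
    stub_reducedPullbackTransfer X' X Z g ρ hρbir
  haveI hfin₂ : IsFinite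
      ((vanishingIdeal (⊤ : Closeds ↑(pullback g ρ))).subschemeι ≫ pullback.snd g ρ) :=
    isFinite_reduced_pullback_snd g ρ
  haveI hui₂ : UniversallyInjective
      ((vanishingIdeal (⊤ : Closeds ↑(pullback g ρ))).subschemeι ≫ pullback.snd g ρ) :=
    universallyInjective_reduced_pullback_snd g ρ
  have hsurj₂ : Surjective
      ((vanishingIdeal (⊤ : Closeds ↑(pullback g ρ))).subschemeι ≫ pullback.snd g ρ) :=
    surjective_reduced_pullback_snd g ρ
  -- `P` is LRR: a finite radicial cover of the normal LRR `Z`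
  haveI : LocallyOfFiniteType (ρ ≫ f) := inferInstance
  have hPlrr := stub_lrr_of_finite_universallyInjective p hp k
    (vanishingIdeal (⊤ : Closeds ↑(pullback g ρ))).subscheme Z (ρ ≫ f)
    ((vanishingIdeal (⊤ : Closeds ↑(pullback g ρ))).subschemeι ≫ pullback.snd g ρ)
    hsurj₂.surj hZn hZlrr
  -- normalise the LRR modification `P → X'`
  haveI : LocallyOfFiniteType
      (((vanishingIdeal (⊤ : Closeds ↑(pullback g ρ))).subschemeι ≫ pullback.snd g ρ) ≫
        ρ ≫ f) := inferInstance
  haveI : IsProper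
      ((vanishingIdeal (⊤ : Closeds ↑(pullback g ρ))).subschemeι ≫ pullback.fst g ρ) :=
    inferInstance
  exact tame_of_lrr_modification k X'
    (vanishingIdeal (⊤ : Closeds ↑(pullback g ρ))).subscheme
    (((vanishingIdeal (⊤ : Closeds ↑(pullback g ρ))).subschemeι ≫ pullback.snd g ρ) ≫ ρ ≫ f)
    ((vanishingIdeal (⊤ : Closeds ↑(pullback g ρ))).subschemeι ≫ pullback.fst g ρ) hbirP hPlrr

end Summit.ResolutionOfSingularities.ResolutionOfSingularities.Theorems.Pialt.RadiciallyRegular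

end
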